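import Summits.CriticalPhenomena.PercolationContinuityZ3.Theorems.Transplant.BoxProdZ2ConcParamsAtQ
import Summits.CriticalPhenomena.PercolationContinuityZ3.Theorems.Transplant.KNCellsBoxProdZ2ConcRootGB
import HarnessLib

/-!
# (Z), part (R): the ROOT obligation of the CONCRETE choice function — `rootHoldsFn_concChoice₀ : RootHoldsFn concChoice₀` — p2-g2's
# `rootOblA_concGB` (the residue (R) for the schedule of record with the standard first hop, KNCellsBoxProdZ2ConcRootGB) instantiated at
# stmt's `concChoice₀` through the `AtQ` unpacking of `BoxProdZ2ConcParamsAtQ`, then `rootOblT_of_rootOblA`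

builds on p205010 (kernel theorem, internal audit signed; external expert review pending) — nothing in this file uses p205010.
Status sentence (coordinator 2026-08-20T04:30Z): "θ(p_c) = 0 on ℤ^d, all d ≥ 2 — kernel-verified (Lean 4/Mathlib, standard axioms); internal adversarial
audit SIGNED 2026-08-20 04:29Z; external expert review pending."
Lane `prim-bschramm-*`, seat `prim-bschramm-p2` ((R) wrapper, lead g3 16:29:39Z); helper file (`--supports stmt-CriticalPhenomena-4575`).

Constants fed (CONC-PARAMS.md §v1 + (R) block): `t := Conc.tc`, `R' := Conc.R'c = M + L + 1`, `Rlev := j₁ := M + L`, `j₀ := ℓ₀ := M + 1`,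
`N := Conc.Nc`, `kk := Conc.kc`, `V₀ := reps X hqt`, accuracy `κ.δr 44` (inputs at `δmin² ≤ (δr 44)²`), `η := Conc.ηc = δmin/2 ≤ δr 44 / 2`,
`R₁ := Conc.Rexc … q (E₀ + 1)`, root tube `F 1 - L' = E₀ + L' + 1 + Rex(E₀+1)` (`Conc.hRt`), route scales `[M+1, t + R'] ⊆ [M+1, 6t]`, first hop at `6t`.
* **`rootHoldsFn_concChoice₀ : RootHoldsFn concChoice₀`**, `rootHolds_concChoice₀`.
[cite: KozmaNitzan2024, §4 Theorem 6 (pp. 25–31), (32) at the root (p. 28), Lemma 11 (pp. 22–23)]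
-/

noncomputable section

open MeasureTheory
open scoped Classical

namespace Summit.CriticalPhenomena.PercolationContinuityZ3.Theorems

namespace Transplant

namespace BoxProdZ2

open Literature.Probability.Percolation Literature.Probability.LatticeModels SimpleGraph KNCells KNLevels
open Literature.Barriers.CriticalPhenomena (IsQuasiTransitive IsGraphAmenable)

/-- **The root obligation (R) of the concrete choice function.** [cite: KozmaNitzan2024, §4 Theorem 6, (32) at the root (p. 28); Lemma 11 (pp. 22–23)] -/
theorem rootHoldsFn_concChoice₀ : RootHoldsFn concChoice₀ := by
  intro κ W _ _ X _ hΔ hc hqt ha hinf w p hp0 hp1 hT msel M₀ q hat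
  have hδA : 0 < δA X κ hΔ := δA_pos X κ hΔ
  have hη : Conc.ηc κ (δA X κ hΔ) ≤ κ.δr Conc.nR / 2 := by
    unfold Conc.ηc
    linarith [δmin_le_δr κ Conc.nR (δA X κ hΔ)]
  -- numeric side conditions of the root run
  have hR100 := Conc.hR100 (κ := κ) (X := X) (hqt := hqt) (p := p) (hT := hT) (δA := δA X κ hΔ) (M := M₀)
  have hRl := Conc.hRl (κ := κ) (X := X) (hqt := hqt) (p := p) (hT := hT) (δA := δA X κ hΔ) (M := M₀)
  have hℓ₀ := Conc.hℓ₀ (κ := κ) (X := X) (hqt := hqt) (p := p) (hT := hT) (δA := δA X κ hΔ) (M := M₀)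
  have ht : 1 ≤ Conc.tc κ X hqt p hT (δA X κ hΔ) M₀ := by omega
  have hMt : M₀ + 47 * Conc.R'c κ X hqt p hT (δA X κ hΔ) M₀ + 2 ≤ Conc.tc κ X hqt p hT (δA X κ hΔ) M₀ := by omega
  have htR : Conc.tc κ X hqt p hT (δA X κ hΔ) M₀ + Conc.R'c κ X hqt p hT (δA X κ hΔ) M₀ ≤ 6 * Conc.tc κ X hqt p hT (δA X κ hΔ) M₀ := by omega
  have hM6 : M₀ ≤ 6 * Conc.tc κ X hqt p hT (δA X κ hΔ) M₀ := by omega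
  have hRt := Conc.hRt (κ := κ) (X := X) (hqt := hqt) (w := w) (p := p) (hT := hT) (δA := δA X κ hΔ) (M := M₀) (q := q)
  have hE₀R : Conc.E₀c κ X hqt w p hT (δA X κ hΔ) M₀ q ≤
      Frad (Conc.gapc κ X hqt w p hT (δA X κ hΔ) M₀ q) (fun _ => 0) (Conc.E₀c κ X hqt w p hT (δA X κ hΔ) M₀ q) 1 -
        Conc.L'c κ X hqt w p hT (δA X κ hΔ) M₀ q := by rw [hRt]; omega
  have hLR : Conc.L'c κ X hqt w p hT (δA X κ hΔ) M₀ q ≤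
      Frad (Conc.gapc κ X hqt w p hT (δA X κ hΔ) M₀ q) (fun _ => 0) (Conc.E₀c κ X hqt w p hT (δA X κ hΔ) M₀ q) 1 -
        Conc.L'c κ X hqt w p hT (δA X κ hΔ) M₀ q := by
    have := Conc.L'_le_E₀ (κ := κ) (X := X) (hqt := hqt) (w := w) (p := p) (hT := hT) (δA := δA X κ hΔ) (M := M₀) (q := q)
    rw [hRt]; omega
  have hR : Conc.Rexc κ X hqt w p hT (δA X κ hΔ) M₀ q (Conc.E₀c κ X hqt w p hT (δA X κ hΔ) M₀ q + 1) ≤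
      Frad (Conc.gapc κ X hqt w p hT (δA X κ hΔ) M₀ q) (fun _ => 0) (Conc.E₀c κ X hqt w p hT (δA X κ hΔ) M₀ q) 1 -
        Conc.L'c κ X hqt w p hT (δA X κ hΔ) M₀ q - Conc.L'c κ X hqt w p hT (δA X κ hΔ) M₀ q := by rw [hRt]; omega
  have hLψ : ufatRadius X hT (reps X hqt) (Conc.tc κ X hqt p hT (δA X κ hΔ) M₀ + Conc.R'c κ X hqt p hT (δA X κ hΔ) M₀) +
      ufatRadius X hT (reps X hqt) M₀ ≤ Conc.L'c κ X hqt w p hT (δA X κ hΔ) M₀ q :=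
    (Nat.add_le_add_right (ufatRadius_mono X hT (reps X hqt) htR) _).trans Conc.hL_reach
  exact KSchA.rootOblT_of_rootOblA (rootOblA_concGB X (Conc.Cc κ X hqt p hT (δA X κ hΔ) M₀) w (Conc.gapc κ X hqt w p hT (δA X κ hΔ) M₀ q)
    (fun _ => 0) (Conc.E₀c κ X hqt w p hT (δA X κ hΔ) M₀ q) (Conc.L'c κ X hqt w p hT (δA X κ hΔ) M₀ q) q κ.δ (Δ' := κ.Δ + 4) (δr := κ.δr)
    (t := Conc.tc κ X hqt p hT (δA X κ hΔ) M₀) (R' := Conc.R'c κ X hqt p hT (δA X κ hΔ) M₀) (ℓ₀ := M₀ + 1)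
    (Rlev := M₀ + Conc.Lc κ X hqt p hT (δA X κ hΔ) M₀) (N := Conc.Nc κ X hqt p hT (δA X κ hΔ) M₀) (j₀ := M₀ + 1)
    (j₁ := M₀ + Conc.Lc κ X hqt p hT (δA X κ hΔ) M₀) (M := M₀)
    Conc.hr ht hℓ₀ hR100 hMt hRl le_rfl le_rfl (Nat.lt_succ_self _)
    (Conc.hcount_Icc_at hat hp0 hp1 (δmin_le_δr κ Conc.nR (δA X κ hΔ))) hΔ hT (reps X hqt) (frame_reps X hqt)
    (κ.hδr 44).1 (κ.hδr 44).2 (Conc.hmsel_at hat) (Conc.hstd_at hat (δmin_le_δr κ Conc.nR (δA X κ hΔ)))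
    (fun ℓ h1 h2 => Conc.hlink_at hat (δmin_le_δr κ Conc.nR (δA X κ hΔ)) ℓ h1 (h2.trans htR))
    (Conc.hlink_at₁ hat (δmin_le_δr κ Conc.nR (δA X κ hΔ)) hM6 le_rfl)
    Conc.ψ_le_E₀ Conc.ψ_top_le_E₀ hE₀R hLψ hLR
    (Conc.kc κ X hqt p hT (δA X κ hΔ) M₀) (Conc.hN_at hδA hp0 hp1) (Conc.hk_at hat hp0 hp1 (δmin_le_δr κ Conc.nR (δA X κ hΔ)))
    hη (Conc.hRex_at hat le_rfl (Conc.E₀c κ X hqt w p hT (δA X κ hΔ) M₀ q + 1)) hR)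

/-- Hence the root obligation `ConcChoice.RootHolds` at every admissible instance. [folklore] -/
theorem rootHolds_concChoice₀ (κ : ConcConsts) {W : Type} [DecidableEq W] [Countable W] (X : SimpleGraph W) [X.LocallyFinite]
    (hΔ : ∀ v, X.degree v ≤ κ.Δ) (hc : X.Connected) (hqt : IsQuasiTransitive X) (ha : IsGraphAmenable X) (hinf : Infinite W) (w : W)
    (p : unitInterval) (hp0 : 0 < (p : ℝ)) (hp1 : (p : ℝ) < 1) (hT : TubeSubcritical X p) :
    (concChoice₀ κ X hΔ hc hqt ha hinf w p hp0 hp1 hT).RootHolds :=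
  rootHoldsFn_concChoice₀ κ X hΔ hc hqt ha hinf w p hp0 hp1 hT

end BoxProdZ2

end Transplant

end Summit.CriticalPhenomena.PercolationContinuityZ3.Theorems

end
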